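import Summits.QuantumFields.GaugeBoot.TiltedLinkRPGeometry
import HarnessLib

/-!
# Link (mid-plane) reflections on a periodic lattice: plaquettes (gauge-boot, L3(υ) part 2)

HONEST FRAMING (cell `pub-gaugeboot`, page 1 of every file): the venture produces certified bounds
on lattice expectations at stated coupling, gauge group, dimension and torus size; NOT a mass gap,
NOT a continuum limit, NOT a string tension; NOT Yang–Mills-summit-bearing (barriers
`FixedCouplingUltralocality`, `PerturbativeInvisibility`).

Continuation of `TiltedLinkRPGeometry.lean`: the bookkeeping of PLAQUETTES of a periodic lattice
`(A, e)` with a site frame `IsSiteFrame e k σ Q h` relative to the two hyperplanes `h = ½` and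
`h = Q + ½` of the mid-plane (Osterwalder–Seiler) reflection `θ x = σ x + e k` — the verbatim
analogue of the classification in
`Literature.MathematicalPhysics.QuantumFieldTheory.ConstructiveQFTWave0Proofs` (cubic torus, time
axis `0`):

* `IsMidCrossPlaq` — a plaquette with a `k`-side based in a layer `h = 0` or `h = Q` (it is cut by a
  reflection hyperplane; two of its links are crossing links);
* `IsMidPosPlaq` — all four links positive (base height `c` with `1 ≤ c ≤ Q`, and `c + 1 ≤ Q` if the
  plaquette has a `k`-side); `IsMidNegPlaq` — neither;
* `plaqMidReflect` — the reflected plaquette (base `σ x` if it has a `k`-side, `θ x` otherwise; same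
  directions), an involution exchanging positive and negative plaquettes
  (`isMidPosPlaq_plaqMidReflect_iff`) and fixing the crossing ones;
* the links of positive plaquettes are positive (`isMidPosLink_of_isMidPosPlaq`), and the three
  links of the HALF of a crossing plaquette on the positive side of its hyperplane are two crossing
  links and one positive link (`links_of_lower`, `links_of_upper`; `otherDir` is the direction of
  the plaquette other than `k`).

References: K. Osterwalder, E. Seiler, Ann. Phys. 110 (1978) 440, §2; E. Seiler, LNP 159 (1982)
Thm. 2.2.
-/

namespace Summit.QuantumFields.GaugeBoot

namespace TiltedRP

variable {A : Type*} [AddCommGroup A] {d : ℕ}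

/-! ## Plaquette classes and the reflected plaquette -/

section Defs

variable (e : Fin d → A) (k : Fin d) (σ : A →+ A) (Q : ℕ) (h : A →+ ZMod (2 * Q))

/-- The direction of a plaquette other than `k` (for a plaquette with a `k`-side; for the others,
its first direction). -/
def otherDir (p : Plaq A d) : Fin d := if p.2.1.1 = k then p.2.1.2 else p.2.1.1

/-- A CROSSING plaquette: it has a `k`-side and is based in a layer `h = 0` (it is cut by the
hyperplane `h = ½`) or `h = Q` (cut by `h = Q + ½`). -/
def IsMidCrossPlaq (p : Plaq A d) : Prop := HasDir p k ∧ ((h p.1).val = 0 ∨ (h p.1).val = Q)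

/-- A POSITIVE plaquette: all four links are positive links (base height `c` with `1 ≤ c ≤ Q`, and
`c + 1 ≤ Q` if the plaquette has a `k`-side). -/
def IsMidPosPlaq (p : Plaq A d) : Prop :=
  1 ≤ (h p.1).val ∧ (h p.1).val ≤ Q ∧ (HasDir p k → (h p.1).val + 1 ≤ Q)

/-- A NEGATIVE plaquette: neither positive nor crossing (all four links in the reflected half). -/
def IsMidNegPlaq (p : Plaq A d) : Prop := ¬ IsMidPosPlaq k Q h p ∧ ¬ IsMidCrossPlaq k Q h p

/-- The reflected plaquette: base point `σ x = θ x - e_k` if the plaquette has a `k`-side, `θ x`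
otherwise; same directions. -/
def plaqMidReflect (p : Plaq A d) : Plaq A d :=
  (midReflect e k σ p.1 + (if p.2.1.1 = k ∨ p.2.1.2 = k then -e k else 0), p.2)

variable {e k σ Q h}

/-- The base point of the reflected plaquette, with a `k`-side: `σ x`. -/
theorem plaqMidReflect_fst_of_hasDir {p : Plaq A d} (hp : HasDir p k) :
    (plaqMidReflect e k σ p).1 = σ p.1 := by
  have hp' : p.2.1.1 = k ∨ p.2.1.2 = k := hp
  simp [plaqMidReflect, hp']

/-- The base point of the reflected plaquette, without `k`-side: `θ x`. -/
theorem plaqMidReflect_fst_of_not_hasDir {p : Plaq A d} (hp : ¬ HasDir p k) :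
    (plaqMidReflect e k σ p).1 = midReflect e k σ p.1 := by
  have hp' : ¬ (p.2.1.1 = k ∨ p.2.1.2 = k) := hp
  simp [plaqMidReflect, hp']

/-- The reflected plaquette has the same directions. -/
@[simp] theorem plaqMidReflect_snd (p : Plaq A d) : (plaqMidReflect e k σ p).2 = p.2 := rfl

/-- `HasDir` is unchanged by the reflection. -/
theorem hasDir_plaqMidReflect (p : Plaq A d) (m : Fin d) :
    HasDir (plaqMidReflect e k σ p) m ↔ HasDir p m :=
  Iff.rfl

/-- `otherDir` is unchanged by the reflection. -/
@[simp] theorem otherDir_plaqMidReflect (p : Plaq A d) :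
    otherDir k (plaqMidReflect e k σ p) = otherDir k p := rfl

omit [AddCommGroup A] in
/-- The other direction of a plaquette with a `k`-side is not `k`. -/
theorem otherDir_ne {p : Plaq A d} (hp : HasDir p k) : otherDir k p ≠ k := by
  obtain ⟨x, ⟨⟨l, m⟩, hlm⟩⟩ := p
  have hlm' : l ≠ m := ne_of_lt hlm
  simp only [HasDir] at hp
  unfold otherDir
  simp only
  split_ifs with hl
  · subst hl; exact fun h' => hlm' h'.symm
  · rcases hp with hp | hp
    · exact absurd hp hl
    · subst hp; exact hl

omit [AddCommGroup A] in
/-- A plaquette with a `k`-side has directions `k` and `otherDir k p`, in one of the two orders. -/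
theorem dirs_eq_or_of_hasDir {p : Plaq A d} (hp : HasDir p k) :
    (p.2.1.1 = k ∧ p.2.1.2 = otherDir k p) ∨ (p.2.1.1 = otherDir k p ∧ p.2.1.2 = k) := by
  simp only [HasDir] at hp
  unfold otherDir
  split_ifs with hl
  · exact Or.inl ⟨hl, rfl⟩
  · rcases hp with hp | hp
    · exact absurd hp hl
    · exact Or.inr ⟨rfl, hp⟩

/-- Positivity of a plaquette with a `k`-side: `1 ≤ c` and `c + 1 ≤ Q`. -/
theorem isMidPosPlaq_iff_of_hasDir {p : Plaq A d} (hp : HasDir p k) :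
    IsMidPosPlaq k Q h p ↔ 1 ≤ (h p.1).val ∧ (h p.1).val + 1 ≤ Q := by
  unfold IsMidPosPlaq
  exact ⟨fun ⟨h1, _, h3⟩ => ⟨h1, h3 hp⟩, fun ⟨h1, h2⟩ => ⟨h1, by omega, fun _ => h2⟩⟩

/-- Positivity of a plaquette without `k`-side: `1 ≤ c ≤ Q`. -/
theorem isMidPosPlaq_iff_of_not_hasDir {p : Plaq A d} (hp : ¬ HasDir p k) :
    IsMidPosPlaq k Q h p ↔ 1 ≤ (h p.1).val ∧ (h p.1).val ≤ Q := by
  unfold IsMidPosPlaq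
  exact ⟨fun ⟨h1, h2, _⟩ => ⟨h1, h2⟩, fun ⟨h1, h2⟩ => ⟨h1, h2, fun h' => absurd h' hp⟩⟩

/-- Crossing, for a plaquette with a `k`-side: base height `0` or `Q`. -/
theorem isMidCrossPlaq_iff_of_hasDir {p : Plaq A d} (hp : HasDir p k) :
    IsMidCrossPlaq k Q h p ↔ (h p.1).val = 0 ∨ (h p.1).val = Q := by
  unfold IsMidCrossPlaq
  exact ⟨fun h' => h'.2, fun h' => ⟨hp, h'⟩⟩

/-- A plaquette without `k`-side is not crossing. -/
theorem not_isMidCrossPlaq_of_not_hasDir {p : Plaq A d} (hp : ¬ HasDir p k) :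
    ¬ IsMidCrossPlaq k Q h p :=
  fun h' => hp h'.1

end Defs

namespace IsSiteFrame

variable {e : Fin d → A} {k : Fin d} {σ : A →+ A} {Q : ℕ} {h : A →+ ZMod (2 * Q)}
variable (hF : IsSiteFrame e k σ Q h)
include hF

/-! ## The reflection of plaquettes -/

/-- `plaqMidReflect` is an involution. -/
@[simp] theorem plaqMidReflect_plaqMidReflect (p : Plaq A d) :
    plaqMidReflect e k σ (plaqMidReflect e k σ p) = p := by
  obtain ⟨x, q⟩ := p
  by_cases hp : HasDir (x, q) k
  · have hp' : HasDir (plaqMidReflect e k σ (x, q)) k := hp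
    ext1
    · rw [plaqMidReflect_fst_of_hasDir hp', plaqMidReflect_fst_of_hasDir hp]
      exact hF.invol x
    · rfl
  · have hp' : ¬ HasDir (plaqMidReflect e k σ (x, q)) k := hp
    ext1
    · rw [plaqMidReflect_fst_of_not_hasDir hp', plaqMidReflect_fst_of_not_hasDir hp]
      exact hF.midReflect_midReflect x
    · rfl

omit hF in
/-- Positive and crossing are exclusive. -/
theorem not_isMidCrossPlaq_of_isMidPosPlaq {p : Plaq A d} (hp : IsMidPosPlaq k Q h p) :
    ¬ IsMidCrossPlaq k Q h p := by
  rintro ⟨hK, hc⟩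
  rw [isMidPosPlaq_iff_of_hasDir hK] at hp
  omega

/-- **`plaqMidReflect` carries negative plaquettes to positive ones.** -/
theorem isMidPosPlaq_plaqMidReflect_iff (p : Plaq A d) :
    IsMidPosPlaq k Q h (plaqMidReflect e k σ p) ↔ IsMidNegPlaq k Q h p := by
  have hQ := hF.two_le
  have hc := val_lt_two_mul hQ (h p.1)
  unfold IsMidNegPlaq
  by_cases hK : HasDir p k
  · have hK' : HasDir (plaqMidReflect e k σ p) k := hK
    rw [isMidPosPlaq_iff_of_hasDir hK', isMidPosPlaq_iff_of_hasDir hK,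
      isMidCrossPlaq_iff_of_hasDir hK, plaqMidReflect_fst_of_hasDir hK, hF.val_height_map']
    split_ifs <;> omega
  · have hK' : ¬ HasDir (plaqMidReflect e k σ p) k := hK
    rw [isMidPosPlaq_iff_of_not_hasDir hK', isMidPosPlaq_iff_of_not_hasDir hK,
      plaqMidReflect_fst_of_not_hasDir hK, hF.val_height_midReflect]
    rw [and_iff_left (not_isMidCrossPlaq_of_not_hasDir (Q := Q) (h := h) hK)]
    split_ifs <;> omega

/-- `plaqMidReflect` carries positive plaquettes to negative ones. -/
theorem isMidNegPlaq_plaqMidReflect_iff (p : Plaq A d) :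
    IsMidNegPlaq k Q h (plaqMidReflect e k σ p) ↔ IsMidPosPlaq k Q h p := by
  rw [← hF.isMidPosPlaq_plaqMidReflect_iff, hF.plaqMidReflect_plaqMidReflect]

/-- Crossing plaquettes are fixed by `plaqMidReflect` (their base lies in a layer). -/
theorem plaqMidReflect_of_isMidCrossPlaq {p : Plaq A d} (hp : IsMidCrossPlaq k Q h p) :
    plaqMidReflect e k σ p = p := by
  obtain ⟨x, q⟩ := p
  obtain ⟨hK, hc⟩ := hp
  ext1
  · rw [plaqMidReflect_fst_of_hasDir hK]
    exact hF.map_of_val hc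
  · rfl

/-! ## The links of positive plaquettes -/

/-- A `k`-link based at height `c` with `1 ≤ c`, `c + 1 ≤ Q` is positive. -/
theorem isMidPosLink_self {y : A} (h1 : 1 ≤ (h y).val) (h2 : (h y).val + 1 ≤ Q) :
    IsMidPosLink e Q h (y, k) :=
  (hF.isMidPosLink_self_iff y).2 ⟨h1, h2⟩

/-- An `l`-link, `l ≠ k`, based at height `c` with `1 ≤ c ≤ Q` is positive. -/
theorem isMidPosLink_other {y : A} {l : Fin d} (hl : l ≠ k) (h1 : 1 ≤ (h y).val)
    (h2 : (h y).val ≤ Q) : IsMidPosLink e Q h (y, l) :=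
  (hF.isMidPosLink_other_iff y hl).2 ⟨h1, h2⟩

/-- `val` of the height one step along `e k`, below the top: `c + 1`. -/
theorem val_height_add_self_of_lt {y : A} (hy : (h y).val + 1 < 2 * Q) :
    (h (y + e k)).val = (h y).val + 1 := by
  rw [hF.val_height_add_self, if_neg (by omega)]

/-- **All four links of a positive plaquette are positive links.** -/
theorem isMidPosLink_of_isMidPosPlaq {p : Plaq A d} (hp : IsMidPosPlaq k Q h p) :
    IsMidPosLink e Q h (p.1, p.2.1.1) ∧ IsMidPosLink e Q h (p.1 + e p.2.1.1, p.2.1.2) ∧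
      IsMidPosLink e Q h (p.1 + e p.2.1.2, p.2.1.1) ∧ IsMidPosLink e Q h (p.1, p.2.1.2) := by
  obtain ⟨x, ⟨⟨l, m⟩, hlm⟩⟩ := p
  have hQ := hF.two_le
  have hlm' : l ≠ m := ne_of_lt hlm
  obtain ⟨h1, h2, h3⟩ := hp
  simp only [HasDir] at h1 h2 h3 ⊢
  by_cases hl : l = k
  · subst hl
    have hm : m ≠ l := fun h' => hlm' h'.symm
    have h3' := h3 (Or.inl rfl)
    have hk : (h (x + e l)).val = (h x).val + 1 := hF.val_height_add_self_of_lt (by omega)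
    have ho : h (x + e m) = h x := hF.height_add_other x hm
    exact ⟨hF.isMidPosLink_self h1 h3', hF.isMidPosLink_other hm (by rw [hk]; omega)
      (by rw [hk]; exact h3'), hF.isMidPosLink_self (by rw [ho]; exact h1) (by rw [ho]; exact h3'),
      hF.isMidPosLink_other hm h1 h2⟩
  · by_cases hm : m = k
    · subst hm
      have h3' := h3 (Or.inr rfl)
      have hk : (h (x + e m)).val = (h x).val + 1 := hF.val_height_add_self_of_lt (by omega)
      have ho : h (x + e l) = h x := hF.height_add_other x hl
      exact ⟨hF.isMidPosLink_other hl h1 h2, hF.isMidPosLink_self (by rw [ho]; exact h1)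
        (by rw [ho]; exact h3'), hF.isMidPosLink_other hl (by rw [hk]; omega) (by rw [hk]; exact h3'),
        hF.isMidPosLink_self h1 h3'⟩
    · have hol : h (x + e l) = h x := hF.height_add_other x hl
      have hom : h (x + e m) = h x := hF.height_add_other x hm
      exact ⟨hF.isMidPosLink_other hl h1 h2, hF.isMidPosLink_other hm (by rw [hol]; exact h1)
        (by rw [hol]; exact h2), hF.isMidPosLink_other hl (by rw [hom]; exact h1)
        (by rw [hom]; exact h2), hF.isMidPosLink_other hm h1 h2⟩

/-! ## The links of the positive half of a crossing plaquette -/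

/-- **Lower crossing plaquettes** (base `x` with `h x = 0`, `m` the other direction): `(x, k)` and
`(x + e_m, k)` are lower crossing links, `(x + e_k, m)` is a positive link. -/
theorem links_of_lower {p : Plaq A d} (hp : HasDir p k) (hc : (h p.1).val = 0) :
    IsMidLowerLink k Q h (p.1, k) ∧ IsMidPosLink e Q h (p.1 + e k, otherDir k p) ∧
      IsMidLowerLink k Q h (p.1 + e (otherDir k p), k) := by
  have hQ := hF.two_le
  have hm := otherDir_ne (k := k) hp
  have hk : (h (p.1 + e k)).val = (h p.1).val + 1 := hF.val_height_add_self_of_lt (by omega)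
  refine ⟨⟨rfl, hc⟩, hF.isMidPosLink_other hm (by rw [hk]; omega) (by rw [hk]; omega), ⟨rfl, ?_⟩⟩
  show (h (p.1 + e (otherDir k p))).val = 0
  rw [hF.height_add_other _ hm, hc]

/-- **Upper crossing plaquettes** (base `x` with `h x = Q`, `m` the other direction): `(x, k)` and
`(x + e_m, k)` are upper crossing links, `(x, m)` is a positive link. -/
theorem links_of_upper {p : Plaq A d} (hp : HasDir p k) (hc : (h p.1).val = Q) :
    IsMidUpperLink k Q h (p.1, k) ∧ IsMidPosLink e Q h (p.1, otherDir k p) ∧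
      IsMidUpperLink k Q h (p.1 + e (otherDir k p), k) := by
  have hQ := hF.two_le
  have hm := otherDir_ne (k := k) hp
  refine ⟨⟨rfl, hc⟩, hF.isMidPosLink_other hm (by omega) (by omega), ⟨rfl, ?_⟩⟩
  show (h (p.1 + e (otherDir k p))).val = Q
  rw [hF.height_add_other _ hm, hc]

/-- The second base point `x + e_m` of a crossing plaquette lies in the same layer. -/
theorem val_height_add_otherDir {p : Plaq A d} (hp : HasDir p k) :
    (h (p.1 + e (otherDir k p))).val = (h p.1).val := by
  rw [hF.height_add_other _ (otherDir_ne hp)]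

end IsSiteFrame

end TiltedRP

end Summit.QuantumFields.GaugeBoot
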